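import Summits.Ventures.YMGap.RobustBall.TorusClustering
import Summits.Ventures.YMGap.RobustBall.TorusDoorVariance
import Summits.Ventures.YMGap.Thresholds.OneLinkVarianceBoundSU2
import Summits.Ventures.YMGap.RobustBall.SpecificationConcentrationGibbs
import Literature.Probability.LatticeModels.DobrushinComparisonBoundary
import HarnessLib

/-!
# Venture YMGap, track ROBUST-BALL — GAUSSIAN CONCENTRATION, step T: the finite TORUS `(ℤ/L)^d` (the measure of
# lattice practice), uniformly in the volume, from the robust torus door

HONEST FRAMING. WHAT THIS IS: a venture file (cell `pub-ymgap`, track Y2 ROBUST-BALL, seat ds-3, theorems only): the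
torus twin of `ConcentrationKR.lean`. For a member `W : Perturbation d L N` of the tier-1 ball on the torus `(ℤ/L)^d`
whose perturbed torus specification `perturbedTorusSpec W β` is a Kantorovich–Rubinstein contraction for `suFrobDist`
with neighbourhoods of range `≤ r₁` (`1 ≤ r₁`) and row sums `≤ ρ ≤ 1` — EXACTLY the output of ds-2's robust torus door
`RobustTorusDoor N d β ε₀ ε₁ r ρ` (`r₁ = r ⊔ 1`) — and every bounded measurable observable `f` depending on the links
`Δ` with coordinatewise `suFrobDist`-Lipschitz vector `δ` (the currency of `ClustersWith`):

* SINGLE-LINK INFLUENCE on the torus (`torus_abs_kernel_sub_kernel_le`): for `y ∉ Λ` and `ω = η` off `y`,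
  `|∫ f dγ^T_Λ(·|ω) − ∫ f dγ^T_Λ(·|η)| ≤ 2√N Σ_{z ∈ Δ} δ_z ρ^{⌈‖z − y‖_T / r₁⌉₊}` =: `c_f(y)` (the tree's single-exterior-site
  Dobrushin comparison with the ceiling-profile super-solution);
* THE TORUS GIBBS MEASURE CONCENTRATES (`torus_measureReal_ge_le`, `_le_le`, `torus_measureReal_abs_ge_le`): for
  `μ_{β,W,L} = W.perturbedMeasure (fundamentalRep (Fin N)) β` (the kernel of the full volume), every `r ≥ 0` and
  `V ≥ Σ_{y} c_f(y)²`: `μ_{β,W,L}{|f − ∫ f| ≥ r} ≤ 2 exp(−2 r² / V)` — McDiarmid's inequality with NO boundary term and NO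
  infinite-volume limit (the torus has no boundary), for EVERY `L`;
* FROM THE DOOR (`torus_measureReal_abs_ge_le_of_robustTorusDoor`): `RobustTorusDoor N d β ε₀ ε₁ r ρ`, `0 ≤ ρ ≤ 1` ⇒ the
  same on every torus `L ≥ 3` for every member of `ClusterDomainFR ε₀ ε₁ r`, with some door matrix of range `r ⊔ 1`;
* `SU(2)`, `d = 4`, HYPOTHESIS-FREE (`su2_torus_measureReal_abs_ge_le`, ds-2's variance-route door: `ρ_B = e^{2ε}√(4/3)(9/2)β_W
  + e^{ε}√(2/3)ε ≤ 1`, `0 < β_W ≤ 1/5`) and THE PERIODIC WILSON MEASURE (`su2_wilson_torus_measureReal_abs_ge_le`,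
  `0 < β_W ≤ 4/21`, every `L ≥ 3`): `μ_{β_W/2,L}{|f − ∫ f| ≥ a} ≤ 2 exp(−2 a² / V)`.

For an extensive observable (a sum of translates) `δ` is spread over the volume and `Σ_y c_f(y)²` grows like the number
of terms: Gaussian concentration of the torus empirical averages at the volume scale, uniformly in `L` (the explicit
torus lattice sums are left to a follow-up; on each finite torus `V = Σ_y c_f(y)²` is an explicit finite sum).
WHAT THIS IS NOT: an LDP or a CLT; constants not optimised; strong-coupling LATTICE statements inside the single-link
torus door, nothing about the continuum limit or the Clay Millennium problem.

References: C. Külske, Comm. Math. Phys. 239 (2003) 29–51, Thm. 1; C. McDiarmid, Surveys in Combinatorics 1989,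
Lemma (1.2); the tree's `SpecificationConcentration(Gibbs).lean`, `DobrushinComparisonBoundary.lean`,
`TorusClustering.lean` (ds-2; profile lemmas), `Defs.lean` (`RobustTorusDoor`).
-/

noncomputable section

open MeasureTheory ProbabilityTheory Finset Function Real
open scoped NNReal
open Literature.Probability.LatticeModels Literature.Probability.LatticeModels.DobrushinMetric
open Literature.MathematicalPhysics.QuantumLattice hiding torusNorm
open Literature.MathematicalPhysics.QuantumFieldTheory hiding ZdEdge
open Summit.QuantumFields.BalabanUV.InfraRed.StrongCouplingPoincareDoorSUN (OneLinkPoincareSUN oneLinkPoincareSUN_two_sharp)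
open Summit.QuantumFields.BalabanUV.InfraRed.StrongCouplingVarianceDoorSUN (OneLinkVarianceBound)

namespace Summit.Ventures.YMGap.RobustBall

variable {d L N : ℕ} [NeZero L]

/-! ### The ceiling-profile super-solution around one torus link -/

omit [NeZero L] in
/-- **The ceiling profile `z ↦ ρ^{⌈‖z − y‖_T/r₁⌉₊}` is a super-solution** on the torus for nonnegative coefficients with row
sums `≤ ρ ≤ 1` and range `≤ r₁` (`1 ≤ r₁`): `Σ_{z ∈ nbr x} C x z ρ^{⌈‖z − y‖_T/r₁⌉₊} ≤ ρ^{⌈‖x − y‖_T/r₁⌉₊}`. [folklore] -/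
theorem torus_sum_mul_pow_ceil_le {ρ : ℝ} (hρ0 : 0 ≤ ρ) (hρ1 : ρ ≤ 1) {r₁ : ℕ} (hr₁ : 1 ≤ r₁)
    {nbr : Edge d L → Finset (Edge d L)} {C : Edge d L → Edge d L → ℝ} (hC0 : ∀ x z, 0 ≤ C x z)
    (hrow : ∀ x, ∑ z ∈ nbr x, C x z ≤ ρ) (hnbr : ∀ x, ∀ z ∈ nbr x, torusNorm (x.1 - z.1) ≤ r₁) (y x : Edge d L) :
    ∑ z ∈ nbr x, C x z * ρ ^ ⌈(torusNorm (z.1 - y.1) : ℝ) / r₁⌉₊ ≤ ρ ^ ⌈(torusNorm (x.1 - y.1) : ℝ) / r₁⌉₊ := by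
  have hr₁0 : (0 : ℝ) < r₁ := by exact_mod_cast hr₁
  set n := ⌈(torusNorm (x.1 - y.1) : ℝ) / r₁⌉₊ with hn
  have hz : ∀ z ∈ nbr x, ρ ^ ⌈(torusNorm (z.1 - y.1) : ℝ) / r₁⌉₊ ≤ ρ ^ (n - 1) := fun z hz => by
    refine pow_le_pow_of_le_one hρ0 hρ1 ?_
    -- `‖x − y‖ ≤ ‖x − z‖ + ‖z − y‖ ≤ r₁ + ‖z − y‖`
    have htri : (torusNorm (x.1 - y.1) : ℝ) ≤ torusNorm (z.1 - y.1) + r₁ := by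
      have h1 := torusNorm_sub_le x.1 z.1 y.1
      have h2 := hnbr x z hz
      exact_mod_cast (h1.trans (by omega))
    have h3 : (torusNorm (x.1 - y.1) : ℝ) / r₁ ≤ (torusNorm (z.1 - y.1) : ℝ) / r₁ + 1 := by
      rw [div_add_one hr₁0.ne', div_le_div_iff_of_pos_right hr₁0]
      linarith
    have h4 : n ≤ ⌈(torusNorm (z.1 - y.1) : ℝ) / r₁⌉₊ + 1 :=
      (Nat.ceil_mono h3).trans (by rw [Nat.ceil_add_one (by positivity)])
    omega
  calc ∑ z ∈ nbr x, C x z * ρ ^ ⌈(torusNorm (z.1 - y.1) : ℝ) / r₁⌉₊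
      ≤ ∑ z ∈ nbr x, C x z * ρ ^ (n - 1) :=
        Finset.sum_le_sum fun z hz' => mul_le_mul_of_nonneg_left (hz z hz') (hC0 x z)
    _ = (∑ z ∈ nbr x, C x z) * ρ ^ (n - 1) := (Finset.sum_mul _ _ _).symm
    _ ≤ ρ * ρ ^ (n - 1) := mul_le_mul_of_nonneg_right (hrow x) (pow_nonneg hρ0 _)
    _ ≤ ρ ^ n := by
        rcases Nat.eq_zero_or_pos n with h0 | hpos
        · rw [h0, Nat.zero_sub, pow_zero, mul_one]
          exact hρ1
        · rw [← pow_succ', Nat.sub_add_cancel hpos]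

/-! ### The single-link influence on the torus -/

/-- **SINGLE-LINK BOUNDARY INFLUENCE ON THE TORUS from a robust torus door.** If `perturbedTorusSpec W β` is a KR
contraction for `suFrobDist` with neighbourhoods of range `≤ r₁` (`1 ≤ r₁`) and rows `≤ ρ ≤ 1` (`0 ≤ ρ`), then for every
link set `Λ`, every `y ∉ Λ`, every two configurations `ω = η` off `y` and every bounded measurable `f` depending on `Δ`
with `suFrobDist`-Lipschitz vector `δ`:
`|∫ f dγ^T_Λ(·|ω) − ∫ f dγ^T_Λ(·|η)| ≤ 2√N Σ_{z ∈ Δ} δ_z ρ^{⌈‖z − y‖_T/r₁⌉₊}`. [folklore] -/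
theorem torus_abs_kernel_sub_kernel_le {W : Perturbation d L N} {β : ℝ} {nbr : Edge d L → Finset (Edge d L)}
    {C : Edge d L → Edge d L → ℝ} (hKR : IsKRContraction (perturbedTorusSpec W β) suFrobDist nbr C) {ρ : ℝ}
    (hρ0 : 0 ≤ ρ) (hρ1 : ρ ≤ 1) (hrow : ∀ e, ∑ y ∈ nbr e, C e y ≤ ρ) {r₁ : ℕ} (hr₁ : 1 ≤ r₁)
    (hnbr : ∀ e, ∀ y ∈ nbr e, torusNorm (e.1 - y.1) ≤ r₁) (Λ : Finset (Edge d L)) {y : Edge d L} (hy : y ∉ Λ)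
    {ω η : GaugeConfig d L (SUN N)} (hωη : ∀ z, z ≠ y → ω z = η z) {f : GaugeConfig d L (SUN N) → ℝ}
    (hfm : Measurable f) {Δ : Finset (Edge d L)} (hfdep : DependsOn f (↑Δ : Set (Edge d L))) {M : ℝ}
    (hM : ∀ U, |f U| ≤ M) {δ : Edge d L → ℝ} (hδ : IsLipBound suFrobDist f δ) :
    |(∫ U, f U ∂(perturbedTorusSpec W β Λ ω)) - ∫ U, f U ∂(perturbedTorusSpec W β Λ η)| ≤
      2 * Real.sqrt N * ∑ z ∈ Δ, δ z * ρ ^ ⌈(torusNorm (z.1 - y.1) : ℝ) / r₁⌉₊ := by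
  classical
  have hγ := isSpecification_perturbedTorusSpec W β
  have hD : (0 : ℝ) ≤ 2 * Real.sqrt N := by positivity
  have hdy : (1 : ℝ) ≤ ρ ^ ⌈(torusNorm (y.1 - y.1) : ℝ) / r₁⌉₊ := by
    rw [sub_self, Literature.MathematicalPhysics.QuantumFieldTheory.torusNorm_zero, Nat.cast_zero, zero_div,
      Nat.ceil_zero, pow_zero]
  -- Dobrushin's single-exterior-site comparison needs restricted rows `< 1`: split off the trivial case `ρ = 1`,
  -- where the claimed bound is the oscillation bound over `Δ`.
  rcases lt_or_eq_of_le hρ1 with hlt | heq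
  · have key := abs_kernel_sub_le_of_superSolution hγ hKR (fun _ _ => suFrobDist_nonneg _ _) suFrobDist_le hD
      Λ hy hωη (d := fun z => ρ ^ ⌈(torusNorm (z.1 - y.1) : ℝ) / r₁⌉₊) (fun z => pow_nonneg hρ0 _) hdy
      (fun x _ => torus_sum_mul_pow_ceil_le hρ0 hρ1 hr₁ hKR.nonneg hrow hnbr y x) hρ0 hlt
      (fun x _ => (Finset.sum_le_sum fun z _ => by
        split_ifs
        · exact le_rfl
        · exact hKR.nonneg x z).trans (hrow x))
      hfm hfdep hM hδ
    refine key.trans ?_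
    rw [Finset.mul_sum, Finset.mul_sum]
    refine Finset.sum_le_sum fun z _ => ?_
    have hδz : 0 ≤ δ z := hδ.nonneg z
    have hpz : 0 ≤ ρ ^ ⌈(torusNorm (z.1 - y.1) : ℝ) / r₁⌉₊ := pow_nonneg hρ0 _
    calc suFrobDist (ω y) (η y) * (ρ ^ ⌈(torusNorm (z.1 - y.1) : ℝ) / r₁⌉₊ * δ z)
        ≤ 2 * Real.sqrt N * (ρ ^ ⌈(torusNorm (z.1 - y.1) : ℝ) / r₁⌉₊ * δ z) :=
          mul_le_mul_of_nonneg_right (suFrobDist_le _ _) (mul_nonneg hpz hδz)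
      _ = 2 * Real.sqrt N * (δ z * ρ ^ ⌈(torusNorm (z.1 - y.1) : ℝ) / r₁⌉₊) := by ring
  · -- `ρ = 1`: the trivial bound `|∫ f dγω − ∫ f dγη| ≤ 2√N Σ_z δ_z` (oscillation over `Δ`)
    subst heq
    simp only [one_pow, mul_one]
    haveI := hγ.isProbability Λ ω
    haveI := hγ.isProbability Λ η
    have hosc : ∀ U V : GaugeConfig d L (SUN N), |f U - f V| ≤ 2 * Real.sqrt N * ∑ z ∈ Δ, δ z := fun U V => by
      have h := abs_sub_le_mul_sum_of_dependsOn (R := 2 * Real.sqrt N) suFrobDist_le hfdep hδ U V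
      exact h
    have hint : ∀ ξ, Integrable f (perturbedTorusSpec W β Λ ξ) := fun ξ => by
      haveI := hγ.isProbability Λ ξ
      exact integrable_of_abs_le' hfm hM
    -- both integrals are averages of `f`, so their difference is an average of `f U − f V` ⇒ `≤` the oscillation
    have hprod : |(∫ U, f U ∂(perturbedTorusSpec W β Λ ω)) - ∫ U, f U ∂(perturbedTorusSpec W β Λ η)| ≤
        2 * Real.sqrt N * ∑ z ∈ Δ, δ z := by
      have e : (∫ U, f U ∂(perturbedTorusSpec W β Λ ω)) - ∫ U, f U ∂(perturbedTorusSpec W β Λ η) =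
          ∫ U, ((∫ V, (f U - f V) ∂(perturbedTorusSpec W β Λ η))) ∂(perturbedTorusSpec W β Λ ω) := by
        have hinner : ∀ U, ∫ V, (f U - f V) ∂(perturbedTorusSpec W β Λ η) =
            f U - ∫ V, f V ∂(perturbedTorusSpec W β Λ η) := fun U => by
          rw [integral_sub (integrable_const _) (hint η), integral_const, smul_eq_mul, probReal_univ, one_mul]
        simp_rw [hinner]
        rw [integral_sub (hint ω) (integrable_const _), integral_const, smul_eq_mul, probReal_univ, one_mul]
      rw [e]
      refine (abs_integral_le_integral_abs).trans ?_
      calc ∫ U, |∫ V, (f U - f V) ∂(perturbedTorusSpec W β Λ η)| ∂(perturbedTorusSpec W β Λ ω)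
          ≤ ∫ _U, 2 * Real.sqrt N * ∑ z ∈ Δ, δ z ∂(perturbedTorusSpec W β Λ ω) := by
            refine integral_mono_of_nonneg (ae_of_all _ fun U => abs_nonneg _) (integrable_const _)
              (ae_of_all _ fun U => ?_)
            refine (abs_integral_le_integral_abs).trans ?_
            calc ∫ V, |f U - f V| ∂(perturbedTorusSpec W β Λ η)
                ≤ ∫ _V, 2 * Real.sqrt N * ∑ z ∈ Δ, δ z ∂(perturbedTorusSpec W β Λ η) :=
                  integral_mono_of_nonneg (ae_of_all _ fun V => abs_nonneg _) (integrable_const _)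
                    (ae_of_all _ fun V => hosc U V)
              _ = 2 * Real.sqrt N * ∑ z ∈ Δ, δ z := by rw [integral_const, smul_eq_mul, probReal_univ, one_mul]
        _ = 2 * Real.sqrt N * ∑ z ∈ Δ, δ z := by rw [integral_const, smul_eq_mul, probReal_univ, one_mul]
    exact hprod

/-! ### The torus Gibbs measure concentrates (McDiarmid on the full volume) -/

/-- **GAUSSIAN CONCENTRATION UNDER THE TORUS GIBBS MEASURE, upper tail**: under the hypotheses of
`torus_abs_kernel_sub_kernel_le`, for every `r ≥ 0` and every `V ≥ Σ_y (2√N Σ_{z∈Δ} δ_z ρ^{⌈‖z − y‖_T/r₁⌉₊})²`: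
`μ_{β,W,L}{f − ∫ f dμ_{β,W,L} ≥ r} ≤ exp(−2 r² / V)` — the kernel of the FULL volume is the torus measure
(`perturbedTorusSpec_univ`), so McDiarmid's inequality applies with no boundary term. [folklore] -/
theorem torus_measureReal_ge_le {W : Perturbation d L N} {β : ℝ} {nbr : Edge d L → Finset (Edge d L)}
    {C : Edge d L → Edge d L → ℝ} (hKR : IsKRContraction (perturbedTorusSpec W β) suFrobDist nbr C) {ρ : ℝ}
    (hρ0 : 0 ≤ ρ) (hρ1 : ρ ≤ 1) (hrow : ∀ e, ∑ y ∈ nbr e, C e y ≤ ρ) {r₁ : ℕ} (hr₁ : 1 ≤ r₁)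
    (hnbr : ∀ e, ∀ y ∈ nbr e, torusNorm (e.1 - y.1) ≤ r₁) {f : GaugeConfig d L (SUN N) → ℝ}
    (hfm : Measurable f) {Δ : Finset (Edge d L)} (hfdep : DependsOn f (↑Δ : Set (Edge d L))) {M : ℝ}
    (hM : ∀ U, |f U| ≤ M) {δ : Edge d L → ℝ} (hδ : IsLipBound suFrobDist f δ) {Vc : ℝ}
    (hV : ∑ y : Edge d L, (2 * Real.sqrt N * ∑ z ∈ Δ, δ z * ρ ^ ⌈(torusNorm (z.1 - y.1) : ℝ) / r₁⌉₊) ^ 2 ≤ Vc)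
    {r : ℝ} (hr : 0 ≤ r) :
    (W.perturbedMeasure (fundamentalRep (Fin N)) β).real
        {U | r ≤ f U - ∫ U', f U' ∂(W.perturbedMeasure (fundamentalRep (Fin N)) β)} ≤ exp (-2 * r ^ 2 / Vc) := by
  have hγ := isSpecification_perturbedTorusSpec W β
  have h := SpecConcentration.measureReal_kernel_ge_le_of_le hγ Finset.univ hfm hM
    (c := fun y => 2 * Real.sqrt N * ∑ z ∈ Δ, δ z * ρ ^ ⌈(torusNorm (z.1 - y.1) : ℝ) / r₁⌉₊)
    (fun y => mul_nonneg (by positivity) (Finset.sum_nonneg fun z _ => mul_nonneg (hδ.nonneg z) (pow_nonneg hρ0 _)))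
    (fun Λ' _ y _ hy ω η hωη => torus_abs_kernel_sub_kernel_le hKR hρ0 hρ1 hrow hr₁ hnbr Λ' hy hωη hfm hfdep hM hδ)
    hV hr (1 : GaugeConfig d L (SUN N))
  rwa [perturbedTorusSpec_univ] at h

/-- **Lower tail under the torus Gibbs measure**: `μ_{β,W,L}{∫ f − f ≥ r} ≤ exp(−2 r² / V)`. [folklore] -/
theorem torus_measureReal_le_le {W : Perturbation d L N} {β : ℝ} {nbr : Edge d L → Finset (Edge d L)}
    {C : Edge d L → Edge d L → ℝ} (hKR : IsKRContraction (perturbedTorusSpec W β) suFrobDist nbr C) {ρ : ℝ}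
    (hρ0 : 0 ≤ ρ) (hρ1 : ρ ≤ 1) (hrow : ∀ e, ∑ y ∈ nbr e, C e y ≤ ρ) {r₁ : ℕ} (hr₁ : 1 ≤ r₁)
    (hnbr : ∀ e, ∀ y ∈ nbr e, torusNorm (e.1 - y.1) ≤ r₁) {f : GaugeConfig d L (SUN N) → ℝ}
    (hfm : Measurable f) {Δ : Finset (Edge d L)} (hfdep : DependsOn f (↑Δ : Set (Edge d L))) {M : ℝ}
    (hM : ∀ U, |f U| ≤ M) {δ : Edge d L → ℝ} (hδ : IsLipBound suFrobDist f δ) {Vc : ℝ}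
    (hV : ∑ y : Edge d L, (2 * Real.sqrt N * ∑ z ∈ Δ, δ z * ρ ^ ⌈(torusNorm (z.1 - y.1) : ℝ) / r₁⌉₊) ^ 2 ≤ Vc)
    {r : ℝ} (hr : 0 ≤ r) :
    (W.perturbedMeasure (fundamentalRep (Fin N)) β).real
        {U | r ≤ (∫ U', f U' ∂(W.perturbedMeasure (fundamentalRep (Fin N)) β)) - f U} ≤ exp (-2 * r ^ 2 / Vc) := by
  have hγ := isSpecification_perturbedTorusSpec W β
  have h := SpecConcentration.measureReal_kernel_le_le_of_le hγ Finset.univ hfm hM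
    (c := fun y => 2 * Real.sqrt N * ∑ z ∈ Δ, δ z * ρ ^ ⌈(torusNorm (z.1 - y.1) : ℝ) / r₁⌉₊)
    (fun y => mul_nonneg (by positivity) (Finset.sum_nonneg fun z _ => mul_nonneg (hδ.nonneg z) (pow_nonneg hρ0 _)))
    (fun Λ' _ y _ hy ω η hωη => torus_abs_kernel_sub_kernel_le hKR hρ0 hρ1 hrow hr₁ hnbr Λ' hy hωη hfm hfdep hM hδ)
    hV hr (1 : GaugeConfig d L (SUN N))
  rwa [perturbedTorusSpec_univ] at h

/-- **Two-sided Gaussian concentration under the torus Gibbs measure**: `μ_{β,W,L}{|f − ∫ f| ≥ r} ≤ 2 exp(−2 r² / V)`,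
for EVERY torus side `L`. [folklore] -/
theorem torus_measureReal_abs_ge_le {W : Perturbation d L N} {β : ℝ} {nbr : Edge d L → Finset (Edge d L)}
    {C : Edge d L → Edge d L → ℝ} (hKR : IsKRContraction (perturbedTorusSpec W β) suFrobDist nbr C) {ρ : ℝ}
    (hρ0 : 0 ≤ ρ) (hρ1 : ρ ≤ 1) (hrow : ∀ e, ∑ y ∈ nbr e, C e y ≤ ρ) {r₁ : ℕ} (hr₁ : 1 ≤ r₁)
    (hnbr : ∀ e, ∀ y ∈ nbr e, torusNorm (e.1 - y.1) ≤ r₁) {f : GaugeConfig d L (SUN N) → ℝ}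
    (hfm : Measurable f) {Δ : Finset (Edge d L)} (hfdep : DependsOn f (↑Δ : Set (Edge d L))) {M : ℝ}
    (hM : ∀ U, |f U| ≤ M) {δ : Edge d L → ℝ} (hδ : IsLipBound suFrobDist f δ) {Vc : ℝ}
    (hV : ∑ y : Edge d L, (2 * Real.sqrt N * ∑ z ∈ Δ, δ z * ρ ^ ⌈(torusNorm (z.1 - y.1) : ℝ) / r₁⌉₊) ^ 2 ≤ Vc)
    {r : ℝ} (hr : 0 ≤ r) :
    (W.perturbedMeasure (fundamentalRep (Fin N)) β).real
        {U | r ≤ |f U - ∫ U', f U' ∂(W.perturbedMeasure (fundamentalRep (Fin N)) β)|} ≤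
      2 * exp (-2 * r ^ 2 / Vc) := by
  haveI : IsProbabilityMeasure (W.perturbedMeasure (fundamentalRep (Fin N)) β) :=
    isProbabilityMeasure_perturbedMeasure W β
  set μ := W.perturbedMeasure (fundamentalRep (Fin N)) β with hμ
  have hsub : {U | r ≤ |f U - ∫ U', f U' ∂μ|} ⊆
      {U | r ≤ f U - ∫ U', f U' ∂μ} ∪ {U | r ≤ (∫ U', f U' ∂μ) - f U} := by
    intro U hU
    simp only [Set.mem_setOf_eq, Set.mem_union] at hU ⊢
    rcases le_or_gt 0 (f U - ∫ U', f U' ∂μ) with h | h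
    · left; rwa [abs_of_nonneg h] at hU
    · right; rw [abs_of_neg h] at hU; linarith
  calc μ.real {U | r ≤ |f U - ∫ U', f U' ∂μ|}
      ≤ μ.real ({U | r ≤ f U - ∫ U', f U' ∂μ} ∪ {U | r ≤ (∫ U', f U' ∂μ) - f U}) := measureReal_mono hsub
    _ ≤ μ.real {U | r ≤ f U - ∫ U', f U' ∂μ} + μ.real {U | r ≤ (∫ U', f U' ∂μ) - f U} :=
        measureReal_union_le _ _
    _ ≤ exp (-2 * r ^ 2 / Vc) + exp (-2 * r ^ 2 / Vc) :=
        add_le_add (torus_measureReal_ge_le hKR hρ0 hρ1 hrow hr₁ hnbr hfm hfdep hM hδ hV hr)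
          (torus_measureReal_le_le hKR hρ0 hρ1 hrow hr₁ hnbr hfm hfdep hM hδ hV hr)
    _ = 2 * exp (-2 * r ^ 2 / Vc) := by ring

/-! ### From the robust torus door: every torus, every member of the tier-1 ball -/

/-- **GAUSSIAN CONCENTRATION ON EVERY TORUS, UNIFORMLY ON THE TIER-1 BALL, from the robust torus door**:
`RobustTorusDoor N d β ε₀ ε₁ r ρ` with `0 ≤ ρ ≤ 1` ⇒ for every torus `L ≥ 3`, every member
`W ∈ ClusterDomainFR ε₀ ε₁ r`, there is a door matrix of range `r ⊔ 1` such that for every bounded measurable local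
observable `f` (links `Δ`, `suFrobDist`-Lipschitz vector `δ`), every `V ≥ Σ_y (2√N Σ_{z∈Δ} δ_z ρ^{⌈‖z−y‖_T/(r⊔1)⌉₊})²`
and every `r' ≥ 0`: `μ_{β,W,L}{|f − ∫ f| ≥ r'} ≤ 2 exp(−2 r'² / V)`. [folklore] -/
theorem torus_measureReal_abs_ge_le_of_robustTorusDoor {β ε₀ ε₁ ρ : ℝ} {r : ℕ}
    (hdoor : RobustTorusDoor N d β ε₀ ε₁ r ρ) (hρ0 : 0 ≤ ρ) (hρ1 : ρ ≤ 1) (hL : 3 ≤ L)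
    {W : Perturbation d L N} (hW : W ∈ ClusterDomainFR ε₀ ε₁ r) {f : GaugeConfig d L (SUN N) → ℝ}
    (hfm : Measurable f) {Δ : Finset (Edge d L)} (hfdep : DependsOn f (↑Δ : Set (Edge d L))) {M : ℝ}
    (hM : ∀ U, |f U| ≤ M) {δ : Edge d L → ℝ} (hδ : IsLipBound suFrobDist f δ) {Vc : ℝ}
    (hV : ∑ y : Edge d L,
      (2 * Real.sqrt N * ∑ z ∈ Δ, δ z * ρ ^ ⌈(torusNorm (z.1 - y.1) : ℝ) / ((max r 1 : ℕ) : ℝ)⌉₊) ^ 2 ≤ Vc)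
    {r' : ℝ} (hr' : 0 ≤ r') :
    (W.perturbedMeasure (fundamentalRep (Fin N)) β).real
        {U | r' ≤ |f U - ∫ U', f U' ∂(W.perturbedMeasure (fundamentalRep (Fin N)) β)|} ≤
      2 * exp (-2 * r' ^ 2 / Vc) := by
  obtain ⟨nbr, C, hKR, hrow, hnbr⟩ := hdoor L hL W hW
  exact torus_measureReal_abs_ge_le hKR hρ0 hρ1 hrow (le_max_right r 1) hnbr hfm hfdep hM hδ hV hr'

/-! ### `SU(2)`, `d = 4`, hypothesis-free (lineage B: sharp Poincaré `2/3`, variance bound `2` for `β_W ≤ 1/5`) -/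

/-- **`SU(2)` TORUS CELL, HYPOTHESIS-FREE** (one-parameter ball `ε₀ = 2ε`, `ε₁ = ε`, tree coupling `β_W/2`,
`0 < β_W ≤ 1/5`): with `ρ_B := e^{2ε} √(4/3) (9/2) β_W + e^{ε} √(2/3) ε ≤ 1`, on every torus `L ≥ 3`, for every member
`W ∈ ClusterDomainFR (2ε) ε r`, every bounded measurable local observable `f` (links `Δ`, `suFrobDist`-Lipschitz vector `δ`),
every `V ≥ Σ_y (2√2 Σ_{z∈Δ} δ_z ρ_B^{⌈‖z−y‖_T/(r⊔1)⌉₊})²` and every `a ≥ 0`: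
`μ_{β_W/2,W,L}{|f − ∫ f| ≥ a} ≤ 2 exp(−2 a² / V)` (ds-2's variance-route torus door + McDiarmid). [folklore] -/
theorem su2_torus_measureReal_abs_ge_le {βW ε : ℝ} (hβ0 : 0 < βW) (hβ : βW ≤ 1 / 5) (hε : 0 ≤ ε) (r : ℕ)
    (hρ1 : Real.exp (2 * ε) * Real.sqrt (2 / 3 * 2) * (9 / 2 * βW) + Real.exp (2 * ε / 2) * Real.sqrt (2 / 3) * ε ≤ 1)
    (hL : 3 ≤ L) {W : Perturbation 4 L 2} (hW : W ∈ ClusterDomainFR (2 * ε) ε r)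
    {f : GaugeConfig 4 L (SUN 2) → ℝ} (hfm : Measurable f) {Δ : Finset (Edge 4 L)}
    (hfdep : DependsOn f (↑Δ : Set (Edge 4 L))) {M : ℝ} (hM : ∀ U, |f U| ≤ M) {δ : Edge 4 L → ℝ}
    (hδ : IsLipBound suFrobDist f δ) {Vc : ℝ}
    (hV : ∑ y : Edge 4 L, (2 * Real.sqrt (2 : ℕ) * ∑ z ∈ Δ, δ z *
        (Real.exp (2 * ε) * Real.sqrt (2 / 3 * 2) * (9 / 2 * βW) + Real.exp (2 * ε / 2) * Real.sqrt (2 / 3) * ε) ^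
          ⌈(torusNorm (z.1 - y.1) : ℝ) / ((max r 1 : ℕ) : ℝ)⌉₊) ^ 2 ≤ Vc)
    {a : ℝ} (ha : 0 ≤ a) :
    (W.perturbedMeasure (fundamentalRep (Fin 2)) (βW / 2)).real
        {U | a ≤ |f U - ∫ U', f U' ∂(W.perturbedMeasure (fundamentalRep (Fin 2)) (βW / 2))|} ≤
      2 * exp (-2 * a ^ 2 / Vc) := by
  have hP : OneLinkPoincareSUN 2 (3 * βW / 2) (2 / 3) := oneLinkPoincareSUN_two_sharp _
  have hVB : OneLinkVarianceBound 2 (3 * βW / 2) 2 := OneLinkVarianceBoundSU2.oneLinkVarianceBound_two_of_le_fifth hβ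
  have hR : |βW / 2| / ((2 : ℕ) : ℝ) * (2 * (((4 : ℕ) : ℝ) - 1)) ≤ 3 * βW / 2 := by
    rw [abs_of_pos (by positivity)]
    push_cast
    linarith
  have hcW : Real.exp (2 * ε) * Real.sqrt (2 / 3 * 2) * (|βW / 2| / ((2 : ℕ) : ℝ)) * (6 * (((4 : ℕ) : ℝ) - 1)) =
      Real.exp (2 * ε) * Real.sqrt (2 / 3 * 2) * (9 / 2 * βW) := by
    rw [abs_of_pos (by positivity)]
    push_cast
    ring
  have hdoor := robustTorusDoor_of_poincare_of_varianceBound (d := 4) (N := 2) (by norm_num) (by norm_num)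
    (β := βW / 2) (ε₀ := 2 * ε) (ε₁ := ε) (by norm_num) (by norm_num) hR hP hVB r
  rw [hcW] at hdoor
  have hρ0 : 0 ≤ Real.exp (2 * ε) * Real.sqrt (2 / 3 * 2) * (9 / 2 * βW) + Real.exp (2 * ε / 2) * Real.sqrt (2 / 3) * ε := by
    positivity
  exact torus_measureReal_abs_ge_le_of_robustTorusDoor hdoor hρ0 hρ1 hL hW hfm hfdep hM hδ hV ha

/-- **THE PERIODIC WILSON MEASURE SELF-AVERAGES, `SU(2)` on `(ℤ/L)⁴`, `0 < β_W ≤ 4/21`** (tree coupling `β_W/2`; the zero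
member, `ε = 0`, `ρ = √(4/3)·(9/2)·β_W ≤ 1` — e.g. `ρ ≤ 0.866` at `β_W = 1/6`): for EVERY torus `L ≥ 3`, every bounded
measurable local observable `f` (links `Δ`, `suFrobDist`-Lipschitz vector `δ`), every
`V ≥ Σ_y (2√2 Σ_{z∈Δ} δ_z ρ^{‖z−y‖_T})²` and every `a ≥ 0`:
`μ_{β_W/2,L}{|f − ∫ f| ≥ a} ≤ 2 exp(−2 a² / V)` — the finite-volume periodic measure that lattice simulations sample.
[folklore] -/
theorem su2_wilson_torus_measureReal_abs_ge_le {βW : ℝ} (hβ0 : 0 < βW) (hβ : βW ≤ 4 / 21) (hL : 3 ≤ L)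
    {f : GaugeConfig 4 L (SUN 2) → ℝ} (hfm : Measurable f) {Δ : Finset (Edge 4 L)}
    (hfdep : DependsOn f (↑Δ : Set (Edge 4 L))) {M : ℝ} (hM : ∀ U, |f U| ≤ M) {δ : Edge 4 L → ℝ}
    (hδ : IsLipBound suFrobDist f δ) {Vc : ℝ}
    (hV : ∑ y : Edge 4 L, (2 * Real.sqrt (2 : ℕ) * ∑ z ∈ Δ, δ z *
        (Real.sqrt (2 / 3 * 2) * (9 / 2 * βW)) ^ ⌈(torusNorm (z.1 - y.1) : ℝ) / ((max 0 1 : ℕ) : ℝ)⌉₊) ^ 2 ≤ Vc)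
    {a : ℝ} (ha : 0 ≤ a) :
    ((0 : Perturbation 4 L 2).perturbedMeasure (fundamentalRep (Fin 2)) (βW / 2)).real
        {U | a ≤ |f U - ∫ U', f U' ∂((0 : Perturbation 4 L 2).perturbedMeasure (fundamentalRep (Fin 2)) (βW / 2))|} ≤
      2 * exp (-2 * a ^ 2 / Vc) := by
  have hW : (0 : Perturbation 4 L 2) ∈ ClusterDomainFR (2 * 0) 0 0 := by
    rw [mul_zero]
    exact zero_mem_clusterDomainFR le_rfl le_rfl 0
  have hs : Real.sqrt (2 / 3 * 2) ≤ 7 / 6 := by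
    rw [show (2 : ℝ) / 3 * 2 = 4 / 3 by norm_num, Real.sqrt_le_left (by norm_num)]
    norm_num
  have hρ1 : Real.exp (2 * 0) * Real.sqrt (2 / 3 * 2) * (9 / 2 * βW) + Real.exp (2 * 0 / 2) * Real.sqrt (2 / 3) * 0 ≤ 1 := by
    rw [mul_zero, zero_div, Real.exp_zero, one_mul, mul_zero, add_zero]
    have h9 : 0 ≤ 9 / 2 * βW := by positivity
    calc Real.sqrt (2 / 3 * 2) * (9 / 2 * βW) ≤ 7 / 6 * (9 / 2 * βW) := mul_le_mul_of_nonneg_right hs h9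
      _ ≤ 1 := by nlinarith
  have h5 : βW ≤ 1 / 5 := hβ.trans (by norm_num)
  have key := su2_torus_measureReal_abs_ge_le hβ0 h5 le_rfl 0 hρ1 hL hW hfm hfdep hM hδ (Vc := Vc) ?_ ha
  · exact key
  · simpa only [mul_zero, zero_div, Real.exp_zero, one_mul, add_zero] using hV

end Summit.Ventures.YMGap.RobustBall

end
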